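import Literature.MathematicalPhysics.QuantumFieldTheory.Balaban1983to89.B9Thm311PlaqClosedReadingsCubeZd
import Literature.MathematicalPhysics.QuantumFieldTheory.Balaban1983to89.B9Eq386ResolventBoundZd
import Literature.MathematicalPhysics.QuantumFieldTheory.Balaban1983to89.B9TracePairingMatrix

/-!
# `Balaban1983to89.B9Thm311CoerciveCompactMatrixFibreZd` — [Balaban1985BackgroundPropagators] pp. 390–391 («|X|² = tr X*X», «X·Y = tr XY»), Thm 3.11 p. 416, Thm 3.3 p. 399,
# (3.86) p. 407 AT PRINT'S OWN FIBRE `𝔸 = M_N(ℂ)` WITH `τ = tr`: THE COERCIVITY CONSTANT, THE EXISTENCE AND `L²_tr` BOUND OF THE GENUINE `G_𝔤(U₀)`, AND THE RESOLVENT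
# COMPARISON, WITH NO TRACE HYPOTHESIS LEFT — the displayed `hτp ∕ hτt ∕ hτs` of this seat's `ℤᵈ`-frame files discharged by g0's `B9TracePairingMatrix` (`tr` tracial,
# Hermitian, faithful), the C⋆-structure of `M_N(ℂ)` being Mathlib's scoped `L²`-operator norm (the cell's `letI … := {}` device of NODE 00 ∕ `B7Prop2Explicit` §6)

statement-level skeleton of published theorems with citation tags; proofs where landed; nothing here is a claim about the
Yang–Mills mass gap

`[Balaban1985BackgroundPropagators]` ("B9", CMP **99** (1985) 389–434) p. 390: *«|X| of a N × N matrix means the Hilbert–Schmidt norm, i.e. |X|² = tr X*X»*; p. 391: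
*«The inner product for these matrices is defined by X·Y = tr XY»*; p. 416 Thm 3.11; p. 399 Thm 3.3; p. 407 (3.84)–(3.86).  PDF held:
`paper:balaban1985-cmp99-background-propagators` pp. 390–391, 407, 416 (re-read by this seat, 2026-08-28).

CITATION HEADER (lean-in-tree rule).  Cell `pub-ymgap` (YM Track A, D-0062 ∕ D-0149), node N06 = [B9], width seat `pub-ymgap-dag-n06-w4` (g4), CLAIM-9 ∕ INTENT-9.  Inputs BY
NAME: this seat's g4 `B9Thm311PlaqClosedReadingsCubeZd.exists_package_plaqClosed_cube`, `B9Thm311CoerciveCompactZd.exists_coercive_of_pdevOn_lt_cube`,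
`B9Thm33GreenL2BoundCubeZd.exists_L2Bound_gopZdH_of_pdevOn_lt_cube`, `B9Eq386ResolventBoundZd.exists_resolventBound_one_of_pdevOn_lt_cube`, g0 `B9TracePairingMatrix`
(`matrixTrace_tracial ∕ _star ∕ _faithful`); Mathlib's scoped instances `Matrix.Norms.L2Operator`.

WHAT IS PROVED (kernel, 0 sorry; theorems only — no `def`, `instance`, `notation`; the C⋆-structure is assembled INSIDE each statement by `letI … := {}`, as NODE 00 does).
At a cube member (`Ω = cubeFam false L a Mc ρ k`, `Λs = cubeLamS …`, `m ≤ k`, `2 ≤ d`, `2 ≤ L ≤ ρ`), fibre `M_N(ℂ)` (`1 ≤ N`), `τ = Matrix.traceLinearMap (Fin N) ℂ ℂ`: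
* ★★★ `exists_coercive_of_pdevOn_lt_cube_matrix` — `∃ α c > 0, ∀ U₀ ∈ U(N)^{bonds}, pdevOn(□₀±3) U₀ < α → ∀ A ∈ E_𝔲(□₀), c·Σ_b Re tr(A(b)*A(b)) ≤ Σ_b Re tr(A(b)*(Δ_a(U₀)A)(b))`.
* ★★★ `exists_L2Bound_gopZdH_of_pdevOn_lt_cube_matrix` — the Hilbert–Schmidt `L²` bound `‖G_𝔤(U₀)J‖ ≤ c⁻¹‖J‖`.
* ★★★ `exists_package_plaqClosed_cube_matrix` — the package (coercive ∧ `G_𝔤` exists ∧ `L²` bound ∧ class (1.7)) on «all plaquettes ≤ β < α».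
* ★★ `exists_resolventBound_one_of_pdevOn_lt_cube_matrix` — the curved-vs-flat comparison bound.

HONEST SCOPE.  Instantiation only (the trace facts are g0's kernel theorems); `α, c` MEMBER-DEPENDENT and NON-QUANTITATIVE; `L²_tr` currency; no decay; count-neutral helper
(`--supports` the K1 item of record); N05 ∕ N06 NOT discharged; K1 NOT closed; one finite `𝕋⁴` programme at fixed `ε`, Bałaban as printed; R4 closes only the conditional
finite-`𝕋⁴` rung `BalabanLadder.UV` — nothing continuum ∕ ℝ⁴ ∕ OS ∕ mass gap ∕ Clay.  Unit `pub-ymgap-dag-n06-w4` (g4), 2026-08-28.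
-/

noncomputable section

namespace Literature.MathematicalPhysics.QuantumFieldTheory.Balaban1983to89.B9Thm311CoerciveCompactMatrixFibreZd

open scoped Matrix.Norms.L2Operator
open B7Prop1Explicit
open B7Prop1Local (pdevOn)
open B7Prop2Explicit (unitaryUnits)
open B8Ineq132 (plaqF)
open B8Eq131Cubes (sqLo sqHi)
open B8Eq131CubesAdmissible (cubeFam)
open B8CubeMemberZd (cubeLamS)
open B8Ineq159FlatCubeMemberPrinted (cubeLamBP)
open B8LeafModelZd (ZdIdx)
open B9SupplySockB9P3ZdLetters (OpsZd deltaAOf)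
open B9SupplySockB9P3ZdAllLettersZd (opsAllZd)
open B9Eq316AveragingTransposeZd (Reg17 alphaQ)
open B9Eq327GreenZd (domSub bondPair)
open B9Eq327GreenZdHerm (domSubH RegularAtH gopZdH restrictLinH)
open B9TracePairingMatrix (matrixTrace_tracial matrixTrace_star matrixTrace_faithful)
open B9Thm311CoerciveCompactZd (exists_coercive_of_pdevOn_lt_cube)
open B9Thm33GreenL2BoundCubeZd (exists_L2Bound_gopZdH_of_pdevOn_lt_cube)
open B9Thm311PlaqClosedReadingsCubeZd (exists_package_plaqClosed_cube)
open B9Eq386ResolventBoundZd (exists_resolventBound_one_of_pdevOn_lt_cube)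

export B7Prop1Explicit (Site)

variable {d : ℕ} (N : ℕ) [NeZero N] {L : ℕ}

/-- ★★★ **THEOREM 3.11 ∕ [4] p. 226 IN QUANTITATIVE CURRENCY AT PRINT'S FIBRE `M_N(ℂ)`, `τ = tr`, NO TRACE HYPOTHESIS LEFT**: at a cube member there are `α > 0`, `c > 0`
such that for EVERY `U₀ ∈ U(N)^{bonds}` with `‖U₀(∂p) − 1‖ < α` on the plaquettes of `□₀ ± 3` and every 𝔲(N)-valued `A ∈ E(□₀)`:
`c·Σ_b Re tr(A(b)*A(b)) ≤ Σ_b Re tr(A(b)* (Δ_a(U₀)A)(b))` — the genuine four-letter `Δ_a` of `opsAllZd` at print's class `cubeLamBP`.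
[cite: Balaban1985BackgroundPropagators, Thm 3.11 p.416, p.390 («|X|² = tr X*X»), p.391 («X·Y = tr XY»); Balaban1984PropagatorsII, p.226] -/
theorem exists_coercive_of_pdevOn_lt_cube_matrix (hd2 : 2 ≤ d) (hL : 2 ≤ L) :
    letI : CStarAlgebra (Matrix (Fin N) (Fin N) ℂ) := {}
    ∀ (ops₀ : ℝ → ZdIdx d L → ℕ → OpsZd d (Matrix (Fin N) (Fin N) ℂ)) (M : ℝ) (i : ZdIdx d L) {a : Site d} {Mc ρ : ℕ}, L ≤ ρ →
      i.Ω = cubeFam false L a Mc ρ i.k → i.Λs = cubeLamS L a Mc ρ i.k → ∀ {m : ℕ}, m ≤ i.k →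
        ∃ α : ℝ, 0 < α ∧ ∃ c : ℝ, 0 < c ∧ ∀ U₀ : Site d → Fin d → (Matrix (Fin N) (Fin N) ℂ)ˣ,
          (∀ x κ, U₀ x κ ∈ unitaryUnits (Matrix (Fin N) (Fin N) ℂ)) →
          pdevOn (fun i' => sqLo L a ρ i.k 0 i' - 3) (fun i' => sqHi L a Mc ρ i.k 0 i' + 3) U₀ < α →
            ∀ A ∈ domSubH (𝔸 := Matrix (Fin N) (Fin N) ℂ) (i.Ω 0),
              c * bondPair (Matrix.traceLinearMap (Fin N) ℂ ℂ) A A ≤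
                bondPair (Matrix.traceLinearMap (Fin N) ℂ ℂ) A
                  (deltaAOf i.η (opsAllZd (Matrix.traceLinearMap (Fin N) ℂ ℂ) L (cubeLamBP L a Mc ρ i.k) ops₀ M i m) U₀ A) := by
  letI : CStarAlgebra (Matrix (Fin N) (Fin N) ℂ) := {}
  intro ops₀ M i a Mc ρ hρ hΩ hΛs m hm
  exact exists_coercive_of_pdevOn_lt_cube (Matrix.traceLinearMap (Fin N) ℂ ℂ) (matrixTrace_faithful N) (matrixTrace_tracial N) (matrixTrace_star N)
    hd2 hL ops₀ M i hρ hΩ hΛs hm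

/-- ★★★ **THM 3.3's (3.42) AT `n = 0` IN THE HILBERT–SCHMIDT `L²` NORM AT PRINT'S FIBRE**: `α > 0`, `c > 0` with `Σ_b |(G_𝔤(U₀)J)(b)|² ≤ c⁻²·Σ_b |J(b)|²` for every `U₀ ∈ U(N)^{bonds}`
with `pdevOn(□₀±3) U₀ < α` and every 𝔲(N)-valued `J ∈ E(□₀)` (`|X|² = tr X*X`). [cite: Balaban1985BackgroundPropagators, Thm 3.3 p.399, (3.42) p.397, p.390; Balaban1984PropagatorsII, (2.22) p.226] -/
theorem exists_L2Bound_gopZdH_of_pdevOn_lt_cube_matrix (hd2 : 2 ≤ d) (hL : 2 ≤ L) :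
    letI : CStarAlgebra (Matrix (Fin N) (Fin N) ℂ) := {}
    ∀ (ops₀ : ℝ → ZdIdx d L → ℕ → OpsZd d (Matrix (Fin N) (Fin N) ℂ)) (M : ℝ) (i : ZdIdx d L) {a : Site d} {Mc ρ : ℕ}, L ≤ ρ →
      i.Ω = cubeFam false L a Mc ρ i.k → i.Λs = cubeLamS L a Mc ρ i.k → ∀ {m : ℕ}, m ≤ i.k →
        ∃ α : ℝ, 0 < α ∧ ∃ c : ℝ, 0 < c ∧ ∀ U₀ : Site d → Fin d → (Matrix (Fin N) (Fin N) ℂ)ˣ,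
          (∀ x κ, U₀ x κ ∈ unitaryUnits (Matrix (Fin N) (Fin N) ℂ)) →
          pdevOn (fun i' => sqLo L a ρ i.k 0 i' - 3) (fun i' => sqHi L a Mc ρ i.k 0 i' + 3) U₀ < α →
            ∀ J ∈ domSubH (𝔸 := Matrix (Fin N) (Fin N) ℂ) (i.Ω 0),
              bondPair (Matrix.traceLinearMap (Fin N) ℂ ℂ)
                  (gopZdH i.η (opsAllZd (Matrix.traceLinearMap (Fin N) ℂ ℂ) L (cubeLamBP L a Mc ρ i.k) ops₀ M i m) (i.Ω 0) U₀ J)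
                  (gopZdH i.η (opsAllZd (Matrix.traceLinearMap (Fin N) ℂ ℂ) L (cubeLamBP L a Mc ρ i.k) ops₀ M i m) (i.Ω 0) U₀ J) ≤
                c⁻¹ ^ 2 * bondPair (Matrix.traceLinearMap (Fin N) ℂ ℂ) J J := by
  letI : CStarAlgebra (Matrix (Fin N) (Fin N) ℂ) := {}
  intro ops₀ M i a Mc ρ hρ hΩ hΛs m hm
  exact exists_L2Bound_gopZdH_of_pdevOn_lt_cube (Matrix.traceLinearMap (Fin N) ℂ ℂ) (matrixTrace_faithful N) (matrixTrace_tracial N) (matrixTrace_star N)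
    hd2 hL ops₀ M i hρ hΩ hΛs hm

/-- ★★★ **THE PACKAGE ON THE CLOSED CLASS (1.7) AT PRINT'S FIBRE**: `α > 0`, `c > 0` such that for every `0 ≤ β < α` and every `U₀ ∈ U(N)^{bonds}` with all plaquettes within `β`
of `1`: (a) `c`-coercive on `E_𝔲(□₀)`, (b) `G_𝔤(U₀)` exists, (c) Hilbert–Schmidt bound `c⁻¹`, (d) the member's class (1.7).
[cite: Balaban1985BackgroundPropagators, Thm 3.11 p.416, Thm 3.3 p.399, (3.35) p.396; Balaban1985RegularSpaces, (1.7) p.77, (1.131) p.99] -/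
theorem exists_package_plaqClosed_cube_matrix (hd2 : 2 ≤ d) (hL : 2 ≤ L) :
    letI : CStarAlgebra (Matrix (Fin N) (Fin N) ℂ) := {}
    ∀ (ops₀ : ℝ → ZdIdx d L → ℕ → OpsZd d (Matrix (Fin N) (Fin N) ℂ)) (M : ℝ) (i : ZdIdx d L) {a : Site d} {Mc ρ : ℕ}, L ≤ ρ →
      i.Ω = cubeFam false L a Mc ρ i.k → i.Λs = cubeLamS L a Mc ρ i.k → ∀ {m : ℕ}, m ≤ i.k →
        ∃ α : ℝ, 0 < α ∧ ∃ c : ℝ, 0 < c ∧ ∀ β : ℝ, 0 ≤ β → β < α → ∀ U₀ : Site d → Fin d → (Matrix (Fin N) (Fin N) ℂ)ˣ,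
          (∀ x κ, U₀ x κ ∈ unitaryUnits (Matrix (Fin N) (Fin N) ℂ)) →
          (∀ (x : Site d) (μ ν : Fin d), ‖plaqF U₀ μ ν x - 1‖ ≤ β) →
            (∀ A ∈ domSubH (𝔸 := Matrix (Fin N) (Fin N) ℂ) (i.Ω 0),
                c * bondPair (Matrix.traceLinearMap (Fin N) ℂ ℂ) A A ≤
                  bondPair (Matrix.traceLinearMap (Fin N) ℂ ℂ) A
                    (deltaAOf i.η (opsAllZd (Matrix.traceLinearMap (Fin N) ℂ ℂ) L (cubeLamBP L a Mc ρ i.k) ops₀ M i m) U₀ A)) ∧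
              RegularAtH i.η (opsAllZd (Matrix.traceLinearMap (Fin N) ℂ ℂ) L (cubeLamBP L a Mc ρ i.k) ops₀ M i m) (i.Ω 0) U₀ ∧
              (∀ J ∈ domSubH (𝔸 := Matrix (Fin N) (Fin N) ℂ) (i.Ω 0),
                bondPair (Matrix.traceLinearMap (Fin N) ℂ ℂ)
                    (gopZdH i.η (opsAllZd (Matrix.traceLinearMap (Fin N) ℂ ℂ) L (cubeLamBP L a Mc ρ i.k) ops₀ M i m) (i.Ω 0) U₀ J)
                    (gopZdH i.η (opsAllZd (Matrix.traceLinearMap (Fin N) ℂ ℂ) L (cubeLamBP L a Mc ρ i.k) ops₀ M i m) (i.Ω 0) U₀ J) ≤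
                  c⁻¹ ^ 2 * bondPair (Matrix.traceLinearMap (Fin N) ℂ ℂ) J J) ∧
              Reg17 L m i.Ω (alphaQ d L / (L : ℝ) ^ 2) U₀ := by
  letI : CStarAlgebra (Matrix (Fin N) (Fin N) ℂ) := {}
  intro ops₀ M i a Mc ρ hρ hΩ hΛs m hm
  exact exists_package_plaqClosed_cube (Matrix.traceLinearMap (Fin N) ℂ ℂ) (matrixTrace_faithful N) (matrixTrace_tracial N) (matrixTrace_star N)
    hd2 hL ops₀ M i hρ hΩ hΛs hm

/-- ★★ **THE CURVED PROPAGATOR AGAINST THE FLAT ONE AT PRINT'S FIBRE** ((3.86) to first order, Hilbert–Schmidt currency): `α > 0`, `c > 0` with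
`Σ_b |(G_𝔤(U₀)J − G_𝔤(1)J)(b)|² ≤ c⁻²·Σ_b |W̃(b)|²`, `W̃ = herm 𝟙_{□₀}(Δ_a(1) − Δ_a(U₀))(G_𝔤(1)J)`, for every `U₀ ∈ U(N)^{bonds}` `α`-small on `□₀ ± 3` and every `J`.
[cite: Balaban1985BackgroundPropagators, (3.84)–(3.86) p.407, Thm 3.11 p.416; Balaban1984PropagatorsII, (2.22) p.226] -/
theorem exists_resolventBound_one_of_pdevOn_lt_cube_matrix (hd2 : 2 ≤ d) (hL : 2 ≤ L) :
    letI : CStarAlgebra (Matrix (Fin N) (Fin N) ℂ) := {}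
    ∀ (ops₀ : ℝ → ZdIdx d L → ℕ → OpsZd d (Matrix (Fin N) (Fin N) ℂ)) (M : ℝ) (i : ZdIdx d L) {a : Site d} {Mc ρ : ℕ}, L ≤ ρ →
      i.Ω = cubeFam false L a Mc ρ i.k → i.Λs = cubeLamS L a Mc ρ i.k → ∀ {m : ℕ}, m ≤ i.k →
        ∃ α : ℝ, 0 < α ∧ ∃ c : ℝ, 0 < c ∧ ∀ U₀ : Site d → Fin d → (Matrix (Fin N) (Fin N) ℂ)ˣ,
          (∀ x κ, U₀ x κ ∈ unitaryUnits (Matrix (Fin N) (Fin N) ℂ)) →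
          pdevOn (fun i' => sqLo L a ρ i.k 0 i' - 3) (fun i' => sqHi L a Mc ρ i.k 0 i' + 3) U₀ < α →
            ∀ J : Site d → Fin d → Matrix (Fin N) (Fin N) ℂ,
              bondPair (Matrix.traceLinearMap (Fin N) ℂ ℂ)
                  (gopZdH i.η (opsAllZd (Matrix.traceLinearMap (Fin N) ℂ ℂ) L (cubeLamBP L a Mc ρ i.k) ops₀ M i m) (i.Ω 0) U₀ J -
                    gopZdH i.η (opsAllZd (Matrix.traceLinearMap (Fin N) ℂ ℂ) L (cubeLamBP L a Mc ρ i.k) ops₀ M i m) (i.Ω 0) 1 J)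
                  (gopZdH i.η (opsAllZd (Matrix.traceLinearMap (Fin N) ℂ ℂ) L (cubeLamBP L a Mc ρ i.k) ops₀ M i m) (i.Ω 0) U₀ J -
                    gopZdH i.η (opsAllZd (Matrix.traceLinearMap (Fin N) ℂ ℂ) L (cubeLamBP L a Mc ρ i.k) ops₀ M i m) (i.Ω 0) 1 J) ≤
                c⁻¹ ^ 2 * bondPair (Matrix.traceLinearMap (Fin N) ℂ ℂ)
                  (restrictLinH (𝔸 := Matrix (Fin N) (Fin N) ℂ) (i.Ω 0)
                    (deltaAOf i.η (opsAllZd (Matrix.traceLinearMap (Fin N) ℂ ℂ) L (cubeLamBP L a Mc ρ i.k) ops₀ M i m) 1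
                        (gopZdH i.η (opsAllZd (Matrix.traceLinearMap (Fin N) ℂ ℂ) L (cubeLamBP L a Mc ρ i.k) ops₀ M i m) (i.Ω 0) 1 J) -
                      deltaAOf i.η (opsAllZd (Matrix.traceLinearMap (Fin N) ℂ ℂ) L (cubeLamBP L a Mc ρ i.k) ops₀ M i m) U₀
                        (gopZdH i.η (opsAllZd (Matrix.traceLinearMap (Fin N) ℂ ℂ) L (cubeLamBP L a Mc ρ i.k) ops₀ M i m) (i.Ω 0) 1 J)) :
                      Site d → Fin d → Matrix (Fin N) (Fin N) ℂ)
                  (restrictLinH (𝔸 := Matrix (Fin N) (Fin N) ℂ) (i.Ω 0)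
                    (deltaAOf i.η (opsAllZd (Matrix.traceLinearMap (Fin N) ℂ ℂ) L (cubeLamBP L a Mc ρ i.k) ops₀ M i m) 1
                        (gopZdH i.η (opsAllZd (Matrix.traceLinearMap (Fin N) ℂ ℂ) L (cubeLamBP L a Mc ρ i.k) ops₀ M i m) (i.Ω 0) 1 J) -
                      deltaAOf i.η (opsAllZd (Matrix.traceLinearMap (Fin N) ℂ ℂ) L (cubeLamBP L a Mc ρ i.k) ops₀ M i m) U₀
                        (gopZdH i.η (opsAllZd (Matrix.traceLinearMap (Fin N) ℂ ℂ) L (cubeLamBP L a Mc ρ i.k) ops₀ M i m) (i.Ω 0) 1 J)) :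
                      Site d → Fin d → Matrix (Fin N) (Fin N) ℂ) := by
  letI : CStarAlgebra (Matrix (Fin N) (Fin N) ℂ) := {}
  intro ops₀ M i a Mc ρ hρ hΩ hΛs m hm
  exact exists_resolventBound_one_of_pdevOn_lt_cube (Matrix.traceLinearMap (Fin N) ℂ ℂ) (matrixTrace_faithful N) (matrixTrace_tracial N) (matrixTrace_star N)
    hd2 hL ops₀ M i hρ hΩ hΛs hm

end Literature.MathematicalPhysics.QuantumFieldTheory.Balaban1983to89.B9Thm311CoerciveCompactMatrixFibreZd

end
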